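import Summits.Ventures.PercRepro.GenQHypAddOneAll

/-!
# PercRepro — «hyperplane + one point» at level `q + 1` and type `t` from the level-`q` balance at type `t` with a
larger constant (night-4, gen 2; the general form of `GenQCornerOneStrong`)

By `Jq_hyp_add_one_eq`, `Jq M (τ ∪ {a}) (q + 1) t = Σ_{B ∈ R_q(τ)} ((q + 3 − t)/(2 + m(B)) − Φ′·dem_t(B))` with
`Φ′ = (q + 3)/(q + 2)`, while the level-`q` balance of `τ` at the same type is
`Jq M τ q t = Σ_{B ∈ R_q(τ)} ((q + 2 − t)/(1 + m(B)) − Φ·dem_t(B))`.  Termwise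
`(q + 3 − t)/(2 + m) ≥ λ·(q + 2 − t)/(1 + m)` with `λ = (q + 3 − t)/(2 (q + 2 − t))` (equality at `m = 0`), so

**`Jq_hyp_add_one_nonneg_of_strong`**: if `τ` satisfies the level-`q` balance at type `t` with the constant
`c(q, t) = Φ′/λ = 2 (q + 3)(q + 2 − t)/((q + 2)(q + 3 − t))` in place of `Φ`, then `0 ≤ Jq M (τ ∪ {a}) (q + 1) t`.
The ratio asked of the level-`q` balance is `c(q, t)/Φ = 2 (q + 3)(q + 1)(q + 2 − t)/((q + 2)² (q + 3 − t))`: at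
`(q, t) = (4, 4)` it is `35/27` (`GenQCornerOneStrong`), at `(4, 3)` it is `35/24`, at the top type `t = q` it is
`4 (q + 3)(q + 1)/(3 (q + 2)²) → 4/3`.  So on the diagonal, corner (i) of level `q + 1` at every type is the level-`q`
balance at that type with a constant at most `4/3 + o(1)` times `Φ`.  Imports `GenQHypAddOneAll`.
-/

namespace PercRepro.GenQ

open Finset ThmH SixFour

variable {α : Type*} [DecidableEq α] {M : Matroid α} [M.Finite]

/-- The constant `c(q, t) = 2 (q + 3)(q + 2 − t) / ((q + 2)(q + 3 − t))`. -/
noncomputable def strongConst (q t : ℕ) : ℚ :=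
  2 * ((q : ℚ) + 3) * ((q : ℚ) + 2 - t) / (((q : ℚ) + 2) * ((q : ℚ) + 3 - t))

/-- The termwise bound `(q + 3 − t)/(2 + m) ≥ ((q + 3 − t)/(2 (q + 2 − t))) · (q + 2 − t)/(1 + m)`
(for `t ≤ q + 1`, `m ≥ 0`). -/
theorem div_two_add_ge (q t : ℕ) (ht : t ≤ q + 1) (m : ℚ) (hm : 0 ≤ m) :
    (((q : ℚ) + 3 - t) / (2 * ((q : ℚ) + 2 - t))) * (((q : ℚ) + 2 - t) * (1 / (1 + m))) ≤
      ((q : ℚ) + 3 - t) * (1 / (2 + m)) := by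
  have ht' : (t : ℚ) ≤ (q : ℚ) + 1 := by exact_mod_cast ht
  have h1 : (0 : ℚ) < (q : ℚ) + 2 - t := by linarith
  have h2 : (0 : ℚ) ≤ (q : ℚ) + 3 - t := by linarith
  have e : (((q : ℚ) + 3 - t) / (2 * ((q : ℚ) + 2 - t))) * (((q : ℚ) + 2 - t) * (1 / (1 + m))) =
      ((q : ℚ) + 3 - t) * (1 / (2 * (1 + m))) := by
    field_simp
  rw [e]
  apply mul_le_mul_of_nonneg_left _ h2
  apply one_div_le_one_div_of_le (by positivity)
  linarith

/-- **«Hyperplane + one point» from the strong level-`q` balance**: for `ρ(τ) = q`, `a ∉ τ ∪ cl(τ)`, `t ≤ q + 1`,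
if `strongConst q t · Σ_{B ∈ R_q(τ)} dem_t(B) ≤ Σ_{B ∈ R_q(τ)} (q + 2 − t)·w_∞(B)`, then
`0 ≤ Jq M (insert a τ) (q + 1) t`. -/
theorem Jq_hyp_add_one_nonneg_of_strong {τ : Finset α} {a : α} {q t : ℕ} (ha : a ∈ gr M) (haτ : a ∉ τ)
    (hacl : a ∉ M.closure (τ : Set α)) (hrτ : M.eRk (τ : Set α) = (q : ℕ∞)) (ht : t ≤ q + 1)
    (hstrong : strongConst q t * ∑ B ∈ Rq M τ q, dem M τ t B ≤
      ∑ B ∈ Rq M τ q, ((q : ℚ) + 2 - t) * wInf M B) :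
    0 ≤ Jq M (insert a τ) (q + 1) t := by
  rw [Jq_hyp_add_one_eq ha haτ hacl hrτ t]
  have ht' : (t : ℚ) ≤ (q : ℚ) + 1 := by exact_mod_cast ht
  set lam : ℚ := ((q : ℚ) + 3 - t) / (2 * ((q : ℚ) + 2 - t)) with hlam
  have hlam0 : 0 ≤ lam := by
    rw [hlam]
    apply div_nonneg <;> linarith
  -- termwise supply bound
  have hterm : ∀ B ∈ Rq M τ q,
      lam * (((q : ℚ) + 2 - t) * wInf M B) ≤ (((q + 1 : ℕ) : ℚ) + 2 - t) * (1 / (2 + (mTr M B : ℚ))) := by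
    intro B _
    unfold wInf
    have := div_two_add_ge q t ht (mTr M B : ℚ) (by positivity)
    push_cast
    have e : ((q : ℚ) + 1 + 2 - t) = (q : ℚ) + 3 - t := by ring
    rw [e]
    exact this
  have hsum := Finset.sum_le_sum hterm
  rw [← Finset.mul_sum] at hsum
  -- the constants: `lam · strongConst q t = Φ′`
  have hconst : lam * strongConst q t = (((q + 1 : ℕ) : ℚ) + 2) / (((q + 1 : ℕ) : ℚ) + 1) := by
    rw [hlam]
    unfold strongConst
    have h1 : (0 : ℚ) < (q : ℚ) + 2 - t := by linarith
    have h2 : (0 : ℚ) < (q : ℚ) + 3 - t := by linarith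
    push_cast
    field_simp
    ring
  rw [Finset.sum_sub_distrib]
  have e2 : ∑ B ∈ Rq M τ q, (((q + 1 : ℕ) : ℚ) + 2) / (((q + 1 : ℕ) : ℚ) + 1) * dem M τ t B =
      (((q + 1 : ℕ) : ℚ) + 2) / (((q + 1 : ℕ) : ℚ) + 1) * ∑ B ∈ Rq M τ q, dem M τ t B :=
    (Finset.mul_sum _ _ _).symm
  rw [e2, ← hconst, mul_assoc]
  have := mul_le_mul_of_nonneg_left hstrong hlam0
  linarith

end PercRepro.GenQ
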